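import Summits.BirchSwinnertonDyer.BirchSwinnertonDyer.Theorems.ByReductionTypeAtTwoSupersingularHalvesTwo
import Literature.NumberTheory.EllipticCurves.AnalyticRankModularityProofs
import HarnessLib

/-!
# Route `ByReductionTypeAtTwo` (rung K4), crux `SupersingularRankZeroAtTwo` (item
# stmt-BirchSwinnertonDyer-19097): the LINE `signed-halves-two` — the crux from FIVE registered stub
# groups, with the published binder shrunk to {modularity, Gross–Zagier–Kolyvagin} (seat `bsd-2adic-ss-1`)

HONEST FRAMING (cell `bsd-2adic`, run/shared/lean/pub/bsd-2adic/, HUMAN RULINGS D-0036/D-0059/D-0074):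
THEOREMS ONLY, stated against the REGISTERED crux constant
`Summit.BirchSwinnertonDyer.BirchSwinnertonDyer.Theses.ByReductionTypeAtTwo.SupersingularRankZeroAtTwo`
and the route's by-name published-input items; every research input an explicit hypothesis; no
definition, no named fact; nothing booked; BSD is NOT proved by any of this (a closed item would close
rung K4's leaf, never the summit). PARTITION (D-0054): X5@2 good-SUPERSINGULAR (B1·O1; 763 book230
classes = 757 r0 + 6 r1; r0 by `a₂ = 0 : 2 : −2 = 208 : 483 : 66`) × p = 2 — types-the-object-of;
closes none.

## What this file adds to `ByReductionTypeAtTwoSupersingularHalvesTwo.lean` (p420436)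

The refined class-level form `supersingularRankZeroAtTwo_of_signedHalves_two` there takes THREE
published binders (`nonempty_modularParametrizationData`, `hasEntireLFunction_rat`,
`rank_eq_analyticRank_of_analyticRank_le_one`). The middle one is REDUNDANT on the crux's class: every
`W` there is globally minimal, so the modular parametrisation datum of `W` (its newform `f` with
`aₙ(f) = aₙ(W)`) already makes `L(W, s)` entire (`WeierstrassCurve.hasEntireLFunction_of_cuspCoeff_eq`,
Diamond–Shurman Thm. 5.10.2 / 8.8.3) — `hasEntireLFunction_of_modularParametrizationData`. Hence:

* `supersingularRankZeroAtTwo_of_line` — THE LINE `signed-halves-two` (planner bsd-2adic-plan GEN 13,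
  2026-08-26T04:35:41Z): the crux from exactly FIVE stub groups —
  (1) `stub_ssPub` = modularity ∧ GZK (both PUBLISHED named facts of the tree);
  (2) `stub_zeroSignedControl` = on `a₂ = 0`: Kobayashi Thm. 1.2 at `2` (`X⁺(E/ℚ_∞)` finitely
      generated `Λ`-torsion) ∧ B. D. Kim Cor. 3.15 at `2` (the signed Euler characteristic) — the
      `p = 2` twins of the tree's odd-`p` fact bodies (print: Kobayashi 2003 p. 1 "Let `p` be an odd
      prime"; Kim 2013 `p` odd), on the REAL objects `Kobayashi2003.SignedSelmerDualData W κ γ 1`;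
  (3) `stub_zeroKobayashiLower` = on `a₂ = 0`: the tree's typed `KobayashiLowerDivisibility W 2 1`
      (Eisenstein half of the signed main conjecture at `(E, 2, +)`; BSTW 2024 PRE needs `p` odd);
  (4) `stub_zeroSignedUpper` = on `a₂ = 0`: the Kato-side signed divisibility at `2` in the Néron
      normalisation (Kobayashi Thm. 4.1 shape; at `2` not in print);
  (5) `stub_traceTwoMillerHalves` = on `a₂ = ±2`: Miller's two halves `MissingLowerBoundAt W 2` ∧
      `MissingUpperBoundAt W 2` themselves — MATH-BOUND: Sprung, JNT 132 (2012) constructs the Coleman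
      map `Col` and the pair `(L♯, L♭)` AT `p = 2` (§§2–6, p. 1486 "we included the prime `p = 2`"),
      but the `♯/♭` Selmer groups, Main Conjecture 1.3 and Thm. 1.4 are for odd `p` only (§7, p. 1499
      "From now on, assume `p` is odd"); Kobayashi's `±` objects are the wrong ones off `a_p = 0`
      (`Col♯ = Col⁻`, `Col♭ = Col⁺` only when `a_p = 0`, ibid. p. 1485); the tree's datum-level
      `♭`-package ∀-closed is crux-equivalent (`supersingularRankZeroAtTwo_iff_flatDatumPackage`).
* `supersingularRankZeroAtTwo_of_routeItems` — the same with stub (1) fed BY NAME from the route's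
  existing published-input items `ModularParametrizationSupply` (stmt-…-19266) and
  `MultPublishedInputsAtTwo` (stmt-…-19921, = GZK): a later item split of the crux needs NO new
  support item, and its glue is this theorem.

Composition certificates; nothing asserted beyond the binders; closes nothing by itself.

References: [Kobayashi2003] Thm. 1.2, Thm. 4.1, Conjecture (p. 2); [BDKim2013] Cor. 3.15;
[Sprung2012] pp. 1485–1486, §7 (p. 1499); [DiamondShurman2005] Thm. 5.10.2, 8.8.3; [BCDTJAMS2001]
Thm. A; [Miller2011LMS] Def. 1.1.
-/

set_option autoImplicit false
-- the Theorems namespace of this sub repeats the summit name by design (D-0017 nested layout)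
set_option linter.dupNamespace false

noncomputable section

open scoped Classical MatrixGroups ModularForm

open CongruenceSubgroup WeierstrassCurve Literature.NumberTheory.EllipticCurves
  Literature.NumberTheory.EllipticCurves.ModularForms Literature.NumberTheory.EllipticCurves.Sprung2017
  Literature.NumberTheory.EllipticCurves.Rank1Residual Literature.NumberTheory.EllipticCurves.Rank1Residual.Typed
  Literature.NumberTheory.EllipticCurves.Kobayashi2003 ZpExtension
  Summit.BirchSwinnertonDyer.Rank1Residual Summit.BirchSwinnertonDyer.Rank1Residual.Supersingular

namespace Summit.BirchSwinnertonDyer.BirchSwinnertonDyer.Theorems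

section EntireL

variable (W : WeierstrassCurve ℚ) [W.IsElliptic] [W.IsGloballyMinimal]

/-- **Modularity ⇒ `L(W, s)` entire, per globally minimal curve.** The modular parametrisation datum of
`W` (named fact `nonempty_modularParametrizationData`, Breuil–Conrad–Diamond–Taylor Thm. A) carries a
newform `f` on `Γ₀(N_W)` with `aₙ(f) = aₙ(W)`; the analytic continuation of `L(f, s)`
(Diamond–Shurman Thm. 5.10.2) is then one of `L(W, s)` — the tree's
`WeierstrassCurve.hasEntireLFunction_of_cuspCoeff_eq`. So the binder `hasEntireLFunction_rat` of the
class-level forms of this crux is redundant next to modularity.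
[cite: DiamondShurman2005, Thm. 5.10.2 and Thm. 8.8.3] -/
theorem hasEntireLFunction_of_modularParametrizationData (hmod : nonempty_modularParametrizationData) :
    W.HasEntireLFunction := by
  haveI : NeZero (W.conductorNorm ℤ) := ⟨(W.conductorNorm_pos_holds).ne'⟩
  obtain ⟨Dm⟩ := hmod W
  exact W.hasEntireLFunction_of_cuspCoeff_eq (strictWidthInfty_Gamma0 _) Dm.f Dm.isNewformOf.2

/-- On the crux's class, analytic rank `0` means `L(E,1) ≠ 0`, granted modularity only
(`analyticRank_eq_zero_iff_holds` + `hasEntireLFunction_of_modularParametrizationData`).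
[cite: DiamondShurman2005, Thm. 5.10.2 and Thm. 8.8.3] -/
theorem entireLFunction_one_ne_zero_of_analyticRank_eq_zero
    (hmod : nonempty_modularParametrizationData) (hr : W.analyticRank = 0) :
    W.entireLFunction 1 ≠ 0 :=
  (W.analyticRank_eq_zero_iff_holds (hasEntireLFunction_of_modularParametrizationData W hmod)).1 hr

end EntireL

/-! ## The line `signed-halves-two`: the crux from its five stub groups -/

section Line

/-- **THE LINE `signed-halves-two` (crux `SupersingularRankZeroAtTwo` from its FIVE registered stub
groups).** On the class "non-CM, analytic rank `0`, good supersingular at `2`" (`a₂ ∈ {0, ±2}`,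
`frobeniusTrace_two_eq_zero_or`): (1) `hPub` = modularity ∧ Gross–Zagier–Kolyvagin (PUBLISHED named
facts; `L(W,s)` entire is derived from modularity, `hasEntireLFunction_of_modularParametrizationData`);
(2) `hCtl` = on `a₂ = 0`, Kobayashi Thm. 1.2 at `2` (`X⁺` f.g. `Λ`-torsion) ∧ Kim Cor. 3.15 at `2`
(signed Euler characteristic for a generator of `char X⁺`), on the REAL objects
`SignedSelmerDualData W κ γ 1` — `p = 2` twins of the tree's odd-`p` fact bodies, NOT in print at `2`;
(3) `hlow` = on `a₂ = 0`, the tree's typed `KobayashiLowerDivisibility W 2 1`; (4) `hup` = on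
`a₂ = 0`, the Kato-side signed divisibility at `2`, Néron normalisation (`char X⁺ = (g)`,
`ι(g·h) = ϖ·ι L♭` over every Pollack pair at `2` — which EXISTS, `exists_isPollackPair_two`); (5)
`hTwo` = on `a₂ = ±2`, Miller's halves `MissingLowerBoundAt W 2` ∧ `MissingUpperBoundAt W 2`
themselves (MATH-BOUND: no `♯/♭` Selmer object at `2` in print — Sprung 2012 §7 "From now on, assume
`p` is odd" — or in the tree). Then `SupersingularRankZeroAtTwo`. Proof: the landed halves
`missingLowerBoundAt_two_of_kobayashiLowerDivisibility_two` /
`missingUpperBoundAt_two_of_signedUpperDivisibility_two` on `a₂ = 0`, `hTwo` on `a₂ = ±2`, then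
`missingPPartAt_of_lower_of_upper` + `bsdp_of_missingPPartAt`. Composition certificate; nothing
asserted beyond the binders. [cite: Kobayashi2003, Thm. 1.2, Thm. 4.1 and Conjecture (p. 2)]
[cite: BDKim2013, Cor. 3.15 (p. 199)] [cite: Sprung2012, §7 (p. 1499)] [cite: Miller2011LMS, Def. 1.1] -/
theorem supersingularRankZeroAtTwo_of_line
    (hPub : nonempty_modularParametrizationData ∧ rank_eq_analyticRank_of_analyticRank_le_one)
    (hCtl : (∀ (W : WeierstrassCurve ℚ) [W.IsElliptic] [W.IsGloballyMinimal],
        ¬ W.HasCM → W.analyticRank = 0 → GoodSS W 2 → W.frobeniusTrace 2 = 0 →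
        ∀ (κ : ZpExtension ℚ 2) (γ : Field.absoluteGaloisGroup ℚ),
          κ.IsCyclotomic → κ.IsTopGenerator γ →
          ∀ D : SignedSelmerDualData W κ γ 1,
            Module.Finite (IwasawaAlgebra 2) D.X ∧ Module.IsTorsion (IwasawaAlgebra 2) D.X) ∧
      (∀ (W : WeierstrassCurve ℚ) [W.IsElliptic] [W.IsGloballyMinimal],
        ¬ W.HasCM → W.analyticRank = 0 → GoodSS W 2 → W.frobeniusTrace 2 = 0 →
        ∀ (κ : ZpExtension ℚ 2) (γ : Field.absoluteGaloisGroup ℚ),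
          κ.IsCyclotomic → κ.IsTopGenerator γ →
          ∀ (D : SignedSelmerDualData W κ γ 1) [Module.Finite (IwasawaAlgebra 2) D.X],
            Module.IsTorsion (IwasawaAlgebra 2) D.X →
          ∀ g : IwasawaAlgebra 2, D.charIdeal = Ideal.span {g} → Finite (W.selmerGroupPInfty 2) →
            ∃ u : ℤ_[2]ˣ, ((PowerSeries.constantCoeff g : ℤ_[2]) : ℚ_[2]) =
              ((u : ℤ_[2]) : ℚ_[2]) * ((2 : ℕ) : ℚ_[2]) ^ (padicValNat 2 W.tamagawaProduct) *
                (Nat.card (W.selmerGroupPInfty 2) : ℚ_[2])))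
    (hlow : ∀ (W : WeierstrassCurve ℚ) [W.IsElliptic] [W.IsGloballyMinimal],
      ¬ W.HasCM → W.analyticRank = 0 → GoodSS W 2 → W.frobeniusTrace 2 = 0 →
        KobayashiLowerDivisibility W 2 1)
    (hup : ∀ (W : WeierstrassCurve ℚ) [W.IsElliptic] [W.IsGloballyMinimal],
      ¬ W.HasCM → W.analyticRank = 0 → GoodSS W 2 → W.frobeniusTrace 2 = 0 →
      ∀ (κ : ZpExtension ℚ 2) (γ : Field.absoluteGaloisGroup ℚ),
        κ.IsCyclotomic → κ.IsTopGenerator γ → IsCyclotomicVariable 2 γ →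
        ∀ [NeZero (W.conductorNorm ℤ)] (f : CuspForm (Gamma0 (W.conductorNorm ℤ)) 2),
          IsNewformOf W f → ∀ (ϖ : ℚ), (ϖ : ℝ) * W.realPeriodRat = plusPeriod f →
        ∀ (Lplus Lminus : IwasawaAlgebra 2), IsPollackPair f 2 Lplus Lminus →
        ∀ (D : SignedSelmerDualData W κ γ 1),
          ∃ g h : IwasawaAlgebra 2, D.charIdeal = Ideal.span {g} ∧
            iwasawaToPowerSeries 2 (g * h) =
              PowerSeries.C (ϖ : ℚ_[2]) * iwasawaToPowerSeries 2 (kobayashiL 1 Lplus Lminus))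
    (hTwo : (∀ (W : WeierstrassCurve ℚ) [W.IsElliptic] [W.IsGloballyMinimal],
        ¬ W.HasCM → W.analyticRank = 0 → GoodSS W 2 →
          (W.frobeniusTrace 2 = 2 ∨ W.frobeniusTrace 2 = -2) → MissingLowerBoundAt W 2) ∧
      (∀ (W : WeierstrassCurve ℚ) [W.IsElliptic] [W.IsGloballyMinimal],
        ¬ W.HasCM → W.analyticRank = 0 → GoodSS W 2 →
          (W.frobeniusTrace 2 = 2 ∨ W.frobeniusTrace 2 = -2) → MissingUpperBoundAt W 2)) :
    Summit.BirchSwinnertonDyer.BirchSwinnertonDyer.Theses.ByReductionTypeAtTwo.SupersingularRankZeroAtTwo := by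
  unfold Summit.BirchSwinnertonDyer.BirchSwinnertonDyer.Theses.ByReductionTypeAtTwo.SupersingularRankZeroAtTwo
  obtain ⟨hmod, hGZK⟩ := hPub
  obtain ⟨h12, hKim⟩ := hCtl
  obtain ⟨hL2, hU2⟩ := hTwo
  intro W _ _ hcm hr hss
  refine bsdp_of_missingPPartAt W 2 hGZK (by omega) (missingPPartAt_of_lower_of_upper W 2 ?_ ?_)
  · rcases frobeniusTrace_two_eq_zero_or W hss.1 hss.2 with ha | ha2
    · exact missingLowerBoundAt_two_of_kobayashiLowerDivisibility_two W hmod hGZK hss.1 ha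
        (entireLFunction_one_ne_zero_of_analyticRank_eq_zero W hmod hr)
        (h12 W hcm hr hss ha) (hKim W hcm hr hss ha) (hlow W hcm hr hss ha)
    · exact hL2 W hcm hr hss ha2
  · rcases frobeniusTrace_two_eq_zero_or W hss.1 hss.2 with ha | ha2
    · exact missingUpperBoundAt_two_of_signedUpperDivisibility_two W hmod hGZK hss.1 ha
        (entireLFunction_one_ne_zero_of_analyticRank_eq_zero W hmod hr)
        (h12 W hcm hr hss ha) (hKim W hcm hr hss ha) (hup W hcm hr hss ha)
    · exact hU2 W hcm hr hss ha2

/-- **The line fed BY NAME from the route's items.** Stub group (1) of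
`supersingularRankZeroAtTwo_of_line` is exactly the conjunction of the route's two existing
published-input items `ModularParametrizationSupply` (stmt-BirchSwinnertonDyer-19266, `:=
nonempty_modularParametrizationData`) and `MultPublishedInputsAtTwo` (stmt-BirchSwinnertonDyer-19921,
`:= rank_eq_analyticRank_of_analyticRank_le_one`), both by `Iff.rfl`; the other four binders are the
research stubs verbatim. So an item split of the crux along this line re-uses those two support items
and its glue is this theorem (`fun hM hG hC hL hU hT ↦ …`). Composition certificate; nothing asserted.
[cite: BCDTJAMS2001, Thm. A] [cite: Miller2011LMS, Def. 1.1] -/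
theorem supersingularRankZeroAtTwo_of_routeItems
    (hM : Summit.BirchSwinnertonDyer.BirchSwinnertonDyer.Theses.ByReductionTypeAtTwo.ModularParametrizationSupply)
    (hG : Summit.BirchSwinnertonDyer.BirchSwinnertonDyer.Theses.ByReductionTypeAtTwo.MultPublishedInputsAtTwo)
    (hCtl : (∀ (W : WeierstrassCurve ℚ) [W.IsElliptic] [W.IsGloballyMinimal],
        ¬ W.HasCM → W.analyticRank = 0 → GoodSS W 2 → W.frobeniusTrace 2 = 0 →
        ∀ (κ : ZpExtension ℚ 2) (γ : Field.absoluteGaloisGroup ℚ),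
          κ.IsCyclotomic → κ.IsTopGenerator γ →
          ∀ D : SignedSelmerDualData W κ γ 1,
            Module.Finite (IwasawaAlgebra 2) D.X ∧ Module.IsTorsion (IwasawaAlgebra 2) D.X) ∧
      (∀ (W : WeierstrassCurve ℚ) [W.IsElliptic] [W.IsGloballyMinimal],
        ¬ W.HasCM → W.analyticRank = 0 → GoodSS W 2 → W.frobeniusTrace 2 = 0 →
        ∀ (κ : ZpExtension ℚ 2) (γ : Field.absoluteGaloisGroup ℚ),
          κ.IsCyclotomic → κ.IsTopGenerator γ →
          ∀ (D : SignedSelmerDualData W κ γ 1) [Module.Finite (IwasawaAlgebra 2) D.X],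
            Module.IsTorsion (IwasawaAlgebra 2) D.X →
          ∀ g : IwasawaAlgebra 2, D.charIdeal = Ideal.span {g} → Finite (W.selmerGroupPInfty 2) →
            ∃ u : ℤ_[2]ˣ, ((PowerSeries.constantCoeff g : ℤ_[2]) : ℚ_[2]) =
              ((u : ℤ_[2]) : ℚ_[2]) * ((2 : ℕ) : ℚ_[2]) ^ (padicValNat 2 W.tamagawaProduct) *
                (Nat.card (W.selmerGroupPInfty 2) : ℚ_[2])))
    (hlow : ∀ (W : WeierstrassCurve ℚ) [W.IsElliptic] [W.IsGloballyMinimal],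
      ¬ W.HasCM → W.analyticRank = 0 → GoodSS W 2 → W.frobeniusTrace 2 = 0 →
        KobayashiLowerDivisibility W 2 1)
    (hup : ∀ (W : WeierstrassCurve ℚ) [W.IsElliptic] [W.IsGloballyMinimal],
      ¬ W.HasCM → W.analyticRank = 0 → GoodSS W 2 → W.frobeniusTrace 2 = 0 →
      ∀ (κ : ZpExtension ℚ 2) (γ : Field.absoluteGaloisGroup ℚ),
        κ.IsCyclotomic → κ.IsTopGenerator γ → IsCyclotomicVariable 2 γ →
        ∀ [NeZero (W.conductorNorm ℤ)] (f : CuspForm (Gamma0 (W.conductorNorm ℤ)) 2),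
          IsNewformOf W f → ∀ (ϖ : ℚ), (ϖ : ℝ) * W.realPeriodRat = plusPeriod f →
        ∀ (Lplus Lminus : IwasawaAlgebra 2), IsPollackPair f 2 Lplus Lminus →
        ∀ (D : SignedSelmerDualData W κ γ 1),
          ∃ g h : IwasawaAlgebra 2, D.charIdeal = Ideal.span {g} ∧
            iwasawaToPowerSeries 2 (g * h) =
              PowerSeries.C (ϖ : ℚ_[2]) * iwasawaToPowerSeries 2 (kobayashiL 1 Lplus Lminus))
    (hTwo : (∀ (W : WeierstrassCurve ℚ) [W.IsElliptic] [W.IsGloballyMinimal],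
        ¬ W.HasCM → W.analyticRank = 0 → GoodSS W 2 →
          (W.frobeniusTrace 2 = 2 ∨ W.frobeniusTrace 2 = -2) → MissingLowerBoundAt W 2) ∧
      (∀ (W : WeierstrassCurve ℚ) [W.IsElliptic] [W.IsGloballyMinimal],
        ¬ W.HasCM → W.analyticRank = 0 → GoodSS W 2 →
          (W.frobeniusTrace 2 = 2 ∨ W.frobeniusTrace 2 = -2) → MissingUpperBoundAt W 2)) :
    Summit.BirchSwinnertonDyer.BirchSwinnertonDyer.Theses.ByReductionTypeAtTwo.SupersingularRankZeroAtTwo :=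
  supersingularRankZeroAtTwo_of_line ⟨hM, hG⟩ hCtl hlow hup hTwo

end Line

/-! ## Honesty lemmas for the split: the two sub-cruxes by `a₂`, and stub (5) IS the `a₂ = ±2` sub-crux -/

section Split

/-- **The crux is the conjunction of its two `a₂`-sub-cruxes** (planner's glued split
`SSTraceZeroAtTwo ∧ SSTraceTwoAtTwo ⟺ SupersingularRankZeroAtTwo`; glue = the kernel trichotomy
`frobeniusTrace_two_eq_zero_or`). Pure logic; nothing asserted. [cite: Miller2011LMS, Def. 1.1] -/
theorem supersingularRankZeroAtTwo_iff_traceZero_and_traceTwo :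
    Summit.BirchSwinnertonDyer.BirchSwinnertonDyer.Theses.ByReductionTypeAtTwo.SupersingularRankZeroAtTwo ↔
      (∀ (W : WeierstrassCurve ℚ) [W.IsElliptic] [W.IsGloballyMinimal],
          ¬ W.HasCM → W.analyticRank = 0 → GoodSS W 2 → W.frobeniusTrace 2 = 0 → BSDp W 2) ∧
      (∀ (W : WeierstrassCurve ℚ) [W.IsElliptic] [W.IsGloballyMinimal],
          ¬ W.HasCM → W.analyticRank = 0 → GoodSS W 2 →
            (W.frobeniusTrace 2 = 2 ∨ W.frobeniusTrace 2 = -2) → BSDp W 2) := by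
  unfold Summit.BirchSwinnertonDyer.BirchSwinnertonDyer.Theses.ByReductionTypeAtTwo.SupersingularRankZeroAtTwo
  constructor
  · intro h
    exact ⟨fun W _ _ hcm hr hss _ ↦ h W hcm hr hss, fun W _ _ hcm hr hss _ ↦ h W hcm hr hss⟩
  · rintro ⟨h0, h2⟩ W _ _ hcm hr hss
    rcases frobeniusTrace_two_eq_zero_or W hss.1 hss.2 with ha | ha2
    · exact h0 W hcm hr hss ha
    · exact h2 W hcm hr hss ha2

/-- **Stub (5) `stub_traceTwoMillerHalves` IS the `a₂ = ±2` sub-crux, modulo Gross–Zagier–Kolyvagin** —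
the kernel form of the MATH-BOUND tag: the two Miller halves ∀-closed over "non-CM, analytic rank
`0`, good supersingular at `2`, `a₂ = ±2`" are EQUIVALENT (granted `hGZK`, which makes `Ш` finite) to
`BSD₂` on that class (`missingPPartAt_of_lower_of_upper` / `bsdp_of_missingPPartAt` one way,
`missingPPartAt_of_bsdp` / `lower_and_upper_of_missingPPartAt` back). So the line moves NO content on
`a₂ = ±2`: a proof of stub (5) is a proof of the sub-crux; a finer split needs a new OBJECT (a `♯/♭`
Selmer group at `2`), not a new lemma. [cite: Miller2011LMS, Def. 1.1] [cite: Sprung2012, §7 (p. 1499)] -/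
theorem traceTwoMillerHalves_iff_bsdp_traceTwo
    (hGZK : rank_eq_analyticRank_of_analyticRank_le_one) :
    ((∀ (W : WeierstrassCurve ℚ) [W.IsElliptic] [W.IsGloballyMinimal],
        ¬ W.HasCM → W.analyticRank = 0 → GoodSS W 2 →
          (W.frobeniusTrace 2 = 2 ∨ W.frobeniusTrace 2 = -2) → MissingLowerBoundAt W 2) ∧
      (∀ (W : WeierstrassCurve ℚ) [W.IsElliptic] [W.IsGloballyMinimal],
        ¬ W.HasCM → W.analyticRank = 0 → GoodSS W 2 →
          (W.frobeniusTrace 2 = 2 ∨ W.frobeniusTrace 2 = -2) → MissingUpperBoundAt W 2)) ↔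
    (∀ (W : WeierstrassCurve ℚ) [W.IsElliptic] [W.IsGloballyMinimal],
        ¬ W.HasCM → W.analyticRank = 0 → GoodSS W 2 →
          (W.frobeniusTrace 2 = 2 ∨ W.frobeniusTrace 2 = -2) → BSDp W 2) := by
  constructor
  · rintro ⟨hL, hU⟩ W _ _ hcm hr hss ha
    exact bsdp_of_missingPPartAt W 2 hGZK (by omega)
      (missingPPartAt_of_lower_of_upper W 2 (hL W hcm hr hss ha) (hU W hcm hr hss ha))
  · intro h
    have hPP : ∀ (W : WeierstrassCurve ℚ) [W.IsElliptic] [W.IsGloballyMinimal],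
        ¬ W.HasCM → W.analyticRank = 0 → GoodSS W 2 →
          (W.frobeniusTrace 2 = 2 ∨ W.frobeniusTrace 2 = -2) → MissingPPartAt W 2 := by
      intro W _ _ hcm hr hss ha
      haveI : Finite W.sha := (hGZK W (by omega)).2
      exact missingPPartAt_of_bsdp W 2 (h W hcm hr hss ha)
    exact ⟨fun W _ _ hcm hr hss ha ↦ (lower_and_upper_of_missingPPartAt W 2 (hPP W hcm hr hss ha)).1,
      fun W _ _ hcm hr hss ha ↦ (lower_and_upper_of_missingPPartAt W 2 (hPP W hcm hr hss ha)).2⟩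

end Split

end Summit.BirchSwinnertonDyer.BirchSwinnertonDyer.Theorems

end
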